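import Mathlib
import Summits.BirchSwinnertonDyer.BirchSwinnertonDyer.Theorems.GenusKolyvaginAtTwoPowDvdShaCardAtTwoRTNonPhantomPowLayers

/-!
# Route `GenusKolyvaginAtTwo`, crux L_T `PowDvdShaCardAtTwoRT` (stmt-BirchSwinnertonDyer-23242), LINE 18 stub L, bottom rung:
# the NON-PHANTOM lemma at every level `2^L` — (C) the core: `2`-torsion-valued cocycles killing `u` are coboundaries

Seat `bsd-line-gk2-p3` g22 (PROVER 3/3, cell `bsd-f1-sign2`), `--supports stmt-BirchSwinnertonDyer-23242` (helper).
THEOREMS ONLY (no definition, no named fact, no `sorry`). BSD is not proved by any of this; neither is the crux.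
File 3 of 3 of the algebra (`…RTNonPhantomPowBasis` → `…RTNonPhantomPowLayers` → `…RTNonPhantomPowCore`); the natural (surjective) form
and the tree's `H¹` currency follow in `…RTNonPhantomPowAtMultiplicative`.

WHY (series `…RTNonPhantomPow*`, the ALL-LEVELS sequel of files (I)–(VII) `…RTNonPhantom*`). The bottom-rung ENGINE of LINE 18
(LEAD gk2-p1, `RelaxedCount.false_of_bottomRung_engine(_cheb)`, `hres_of_nonPhantom_pow`) feeds the full-order PAIR Čebotarev at
EVERY level `2^M`, whose separation hypothesis `hres` asks that no non-zero class of the span `⟨c(n), res_K y⟩ ≤ H¹(K, E[2^M])`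
dies on `Γ_{K(E[2^M])}` (NON-PHANTOM).  Files (I)–(VII) settled level `4`; this series proves the group-theoretic input at every
level: **for `Γ ↠ GL₂(ℤ/2^L)` the restriction `H¹(Γ/ker, (ℤ/2^L)²) → H¹(⟨u⟩, (ℤ/2^L)²)` to the cyclic group of the Tate
transvection `u = (1 1; 0 1)` is injective** (Lawson–Wuthrich 2016 §7.1/§8 compute these `H¹` to be `ℤ/2` for `L ≥ 2`; the
inertia group of an odd multiplicative prime with `ord_p Δ` odd supplies `u`, and the Kummer condition there makes Selmer
classes principal on `u`).  Phrased for an abstract group `Γ` acting on an abstract additive group `M` through a `1`-cocycle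
`φ : Γ → M` vanishing on the kernel of the action; `P₁, P₂` a pair spanning `M` freely modulo `q = 2^L`.

THIS FILE: §4 with the layers (file (B)) in hand, averaging over `r = uℓ` (`r³ ∈ V_2`), the `S₃`-relation `u r u⁻¹ ≡ r² (mod V_1)`
and the six residue classes `1, u, ℓ, r, r², ru (mod V_1)` show that a `2`-torsion-valued cocycle vanishing on the kernel and at
`u` is a coboundary; §5 the `−1` trick reduces general values to `2`-torsion values keeping `φ u = 0`, and the normalisation
`φ u = u m − m ↦ 0` gives the basis form `coboundary_of_basis_data` (every level `q = 2^L`, `L ≥ 1`).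

References: T. Lawson, C. Wuthrich, *Vanishing of some Galois cohomology groups for elliptic curves*, Springer Proc. Math.
Stat. 188 (2016), §7.1 and §8; J.-P. Serre, *Abelian ℓ-adic representations* (1968), IV A.1.2 (Tate transvection);
B. H. Gross, *Kolyvagin's work on modular elliptic curves* (1991), Prop. 9.1 (the odd-`p` analogue).
-/

-- `Summit.<P>.<Sub>` repeats `BirchSwinnertonDyer` by the tree's layout convention (D-0017)
set_option linter.dupNamespace false
set_option autoImplicit false

open Summit.BirchSwinnertonDyer.BirchSwinnertonDyer.Theorems.GenusExact.NonPhantom (smul_zsmul_comm cocycle_one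
  cocycle_inv cocycle_eq_of_forall_smul_eq cocycle_conj cocycle_mul_of_eq_zero_right cocycle_mul_of_eq_zero_left
  cocycle_sub_coboundary ker_sub_coboundary smul_lincomb forall_smul_eq_of_basis forall_smul_eq_self_of_basis
  exists_eq_two_smul_of_smul_eq)

namespace Summit.BirchSwinnertonDyer.BirchSwinnertonDyer.Theorems.GenusExact.NonPhantomPow

variable {Γ : Type*} [Group Γ] {M : Type*} [AddCommGroup M] [DistribMulAction Γ M]

/-! ## §4 The core: `2`-torsion-valued cocycles killing `u` are coboundaries -/

section Core

variable {P₁ P₂ : M} {q : ℤ} {L : ℕ}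

/-- **Core, values in `M[2]`, every level `q = 2^L` (`L ≥ 1`).**  Basis data, `u, ℓ, s`, the families `z, g`, a cocycle `φ`
vanishing on the kernel of the action with `φ u = 0` and `2φ = 0`: `φ` is a coboundary.  Steps: §3 kills the layers; averaging
over `r = uℓ` (`r³ ∈ V_2`) gives `φ₂ = φ − dm₃` with `φ₂ r = 0`; the `S₃`-relation `u r u⁻¹ ≡ r² (mod V_1)` forces `φ₂ u = 0`;
every `g` is `≡ 1, u, ℓ, r, r², ru (mod V_1)` by the parities of its matrix. [cite: LawsonWuthrich2016, §7.1 and §8] -/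
theorem coboundary_of_two_torsion_values (hL : 1 ≤ L) (hq : q = 2 ^ L) (hqM : ∀ m : M, q • m = 0)
    (hspan : ∀ m : M, ∃ a b : ℤ, m = a • P₁ + b • P₂)
    (hindep : ∀ a b : ℤ, a • P₁ + b • P₂ = 0 → q ∣ a ∧ q ∣ b)
    {u ℓ s : Γ} (huP₁ : u • P₁ = P₁) (huP₂ : u • P₂ = P₁ + P₂)
    (hℓP₁ : ℓ • P₁ = P₁ + P₂) (hℓP₂ : ℓ • P₂ = P₂) (hsP₁ : s • P₁ = P₂) (hsP₂ : s • P₂ = P₁)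
    {z g : ℕ → Γ} (hz : ∀ i, 1 ≤ i → ∀ m : M, z i • m = (1 + 2 ^ i : ℤ) • m)
    (hg₁ : ∀ i, 1 ≤ i → g i • P₁ = (1 + 2 ^ i : ℤ) • P₁) (hg₂ : ∀ i, 1 ≤ i → g i • P₂ = P₂)
    {φ : Γ → M} (hφ : ∀ a b, φ (a * b) = φ a + a • φ b)
    (hker : ∀ ρ : Γ, (∀ m : M, ρ • m = m) → φ ρ = 0) (hφu : φ u = 0) (h2φ : ∀ a, (2 : ℤ) • φ a = 0) :
    ∃ m : M, ∀ a, φ a = a • m - m := by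
  have hqP₁ := hqM P₁
  have hqP₂ := hqM P₂
  have h2q : (2 : ℤ) ∣ q := by rw [hq]; exact dvd_pow_self 2 (by omega)
  have huiP₁ : u⁻¹ • P₁ = P₁ := by rw [inv_smul_eq_iff, huP₁]
  have huiP₂ : u⁻¹ • P₂ = P₂ - P₁ := by rw [inv_smul_eq_iff, smul_sub, huP₁, huP₂]; abel
  have hℓiP₁ : ℓ⁻¹ • P₁ = P₁ - P₂ := by rw [inv_smul_eq_iff, smul_sub, hℓP₁, hℓP₂]; abel
  have hℓiP₂ : ℓ⁻¹ • P₂ = P₂ := by rw [inv_smul_eq_iff, hℓP₂]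
  -- `r = u ℓ`
  obtain ⟨r, hr⟩ : ∃ r : Γ, r = u * ℓ := ⟨_, rfl⟩
  have hrP₁ : r • P₁ = (2 : ℤ) • P₁ + P₂ := by rw [hr, mul_smul, hℓP₁, smul_add, huP₁, huP₂]; abel
  have hrP₂ : r • P₂ = P₁ + P₂ := by rw [hr, mul_smul, hℓP₂, huP₂]
  have hriP₁ : r⁻¹ • P₁ = P₁ - P₂ := by rw [hr, mul_inv_rev, mul_smul, huiP₁, hℓiP₁]
  have hriP₂ : r⁻¹ • P₂ = -P₁ + (2 : ℤ) • P₂ := by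
    rw [hr, mul_inv_rev, mul_smul, huiP₂, smul_sub, hℓiP₁, hℓiP₂]; abel
  have hrrP₁ : (r * r) • P₁ = (5 : ℤ) • P₁ + (3 : ℤ) • P₂ := by
    simp only [mul_smul, hrP₁, hrP₂, smul_add, smul_zsmul_comm]; module
  have hrrP₂ : (r * r) • P₂ = (3 : ℤ) • P₁ + (2 : ℤ) • P₂ := by
    simp only [mul_smul, hrP₁, hrP₂, smul_add]; module
  -- the layer lemma, in exact and in parity form at layer `1`
  have hV : ∀ {i : ℕ}, 1 ≤ i → ∀ (v : Γ) (α β γ δ : ℤ), v • P₁ = (1 + 2 ^ i * α) • P₁ + (2 ^ i * γ) • P₂ →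
      v • P₂ = (2 ^ i * β) • P₁ + (1 + 2 ^ i * δ) • P₂ → φ v = 0 :=
    fun hi v α β γ δ h₁ h₂ ↦ eq_zero_of_mem_layer hq hqM hspan hindep huP₁ huP₂ hℓP₁ hℓP₂ hsP₁ hsP₂ hz hg₁ hg₂ hφ hker
      h2φ hφu hi h₁ h₂
  have fixD : ∀ {i : ℕ}, 1 ≤ i → ∀ (v : Γ) (α β γ δ : ℤ), v • P₁ = (1 + 2 ^ i * α) • P₁ + (2 ^ i * γ) • P₂ →
      v • P₂ = (2 ^ i * β) • P₁ + (1 + 2 ^ i * δ) • P₂ → ∀ x : M, (2 : ℤ) • x = 0 → v • x = x :=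
    fun hi v α β γ δ h₁ h₂ x hx ↦ smul_eq_self_of_layer hqM hspan hindep hi h₁ h₂ hx
  ------------------------------------------------------------------------------------------------
  -- Step 4: averaging over `r`
  have hφr3 : φ (r * r * r) = 0 := by
    refine hV (i := 2) (by norm_num) _ 3 2 2 1 ?_ ?_
    · simp only [mul_smul, hrP₁, hrP₂, smul_add, smul_zsmul_comm]; module
    · simp only [mul_smul, hrP₁, hrP₂, smul_add, smul_zsmul_comm]; module
  have e1 : r • φ r = φ (r * r) - φ r := by rw [eq_sub_iff_add_eq, add_comm, ← hφ]
  have e2 : r • φ (r * r) = -φ r := by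
    have := hφ r (r * r)
    rw [← mul_assoc, hφr3] at this
    rw [eq_neg_iff_add_eq_zero, add_comm]
    exact this.symm
  obtain ⟨m₃, hm₃⟩ : ∃ m₃ : M, m₃ = φ r + φ (r * r) := ⟨_, rfl⟩
  have h2m₃ : (2 : ℤ) • m₃ = 0 := by rw [hm₃, smul_add, h2φ, h2φ, add_zero]
  obtain ⟨φ₂, hφ₂def⟩ : ∃ φ₂ : Γ → M, φ₂ = fun a ↦ φ a - (a • m₃ - m₃) := ⟨_, rfl⟩
  have hφ₂ : ∀ a b, φ₂ (a * b) = φ₂ a + a • φ₂ b := by rw [hφ₂def]; exact cocycle_sub_coboundary hφ m₃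
  have hφ₂app : ∀ a, φ₂ a = φ a - (a • m₃ - m₃) := fun a ↦ by rw [hφ₂def]
  have hφ₂r : φ₂ r = 0 := by
    rw [hφ₂app, hm₃, smul_add, e1, e2,
      show φ r - (φ (r * r) - φ r + -φ r - (φ r + φ (r * r))) = (2 : ℤ) • ((2 : ℤ) • φ r) by module, h2φ, smul_zero]
  have h2φ₂ : ∀ a, (2 : ℤ) • φ₂ a = 0 := fun a ↦ by
    rw [hφ₂app, smul_sub, smul_sub, ← smul_zsmul_comm, h2m₃, h2φ, smul_zero, sub_self, sub_zero]
  have hV₂ : ∀ (v : Γ) (α β γ δ : ℤ), v • P₁ = (1 + 2 ^ 1 * α) • P₁ + (2 ^ 1 * γ) • P₂ →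
      v • P₂ = (2 ^ 1 * β) • P₁ + (1 + 2 ^ 1 * δ) • P₂ → φ₂ v = 0 := by
    intro v α β γ δ h₁ h₂
    rw [hφ₂app, hV le_rfl v α β γ δ h₁ h₂, fixD le_rfl v α β γ δ h₁ h₂ m₃ h2m₃, sub_self, sub_zero]
  have hV₂' : ∀ (v : Γ) (A B C D : ℤ), v • P₁ = A • P₁ + C • P₂ → v • P₂ = B • P₁ + D • P₂ →
      A % 2 = 1 → B % 2 = 0 → C % 2 = 0 → D % 2 = 1 → φ₂ v = 0 := by
    intro v A B C D h₁ h₂ hA hB hC hD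
    obtain ⟨α, rfl⟩ : ∃ α, A = 1 + 2 ^ 1 * α := ⟨(A - 1) / 2, by omega⟩
    obtain ⟨β, rfl⟩ : ∃ β, B = 2 ^ 1 * β := ⟨B / 2, by omega⟩
    obtain ⟨γ, rfl⟩ : ∃ γ, C = 2 ^ 1 * γ := ⟨C / 2, by omega⟩
    obtain ⟨δ, rfl⟩ : ∃ δ, D = 1 + 2 ^ 1 * δ := ⟨(D - 1) / 2, by omega⟩
    exact hV₂ v α β γ δ h₁ h₂
  have fixD' : ∀ (v : Γ) (A B C D : ℤ), v • P₁ = A • P₁ + C • P₂ → v • P₂ = B • P₁ + D • P₂ →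
      A % 2 = 1 → B % 2 = 0 → C % 2 = 0 → D % 2 = 1 → ∀ x : M, (2 : ℤ) • x = 0 → v • x = x := by
    intro v A B C D h₁ h₂ hA hB hC hD
    obtain ⟨α, rfl⟩ : ∃ α, A = 1 + 2 ^ 1 * α := ⟨(A - 1) / 2, by omega⟩
    obtain ⟨β, rfl⟩ : ∃ β, B = 2 ^ 1 * β := ⟨B / 2, by omega⟩
    obtain ⟨γ, rfl⟩ : ∃ γ, C = 2 ^ 1 * γ := ⟨C / 2, by omega⟩
    obtain ⟨δ, rfl⟩ : ∃ δ, D = 1 + 2 ^ 1 * δ := ⟨(D - 1) / 2, by omega⟩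
    exact fixD le_rfl v α β γ δ h₁ h₂
  -- `φ₂ u = 0` from the `S₃`-relation `u r u⁻¹ ≡ r² (mod V_1)`
  have hφ₂u : φ₂ u = 0 := by
    have hd₁ : ((r * r)⁻¹ * (u * r * u⁻¹)) • P₁ = (3 : ℤ) • P₁ + (-4 : ℤ) • P₂ := by
      simp only [mul_smul, mul_inv_rev, hriP₁, hriP₂, huiP₁, hrP₁, huP₁, huP₂, smul_add, smul_sub, smul_neg,
        smul_zsmul_comm]
      module
    have hd₂ : ((r * r)⁻¹ * (u * r * u⁻¹)) • P₂ = (-2 : ℤ) • P₁ + (3 : ℤ) • P₂ := by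
      simp only [mul_smul, mul_inv_rev, hriP₁, hriP₂, huiP₂, hrP₁, hrP₂, huP₁, huP₂, smul_add, smul_sub, smul_neg,
        smul_zsmul_comm]
      module
    have hv₀ : φ₂ ((r * r)⁻¹ * (u * r * u⁻¹)) = 0 :=
      hV₂' _ _ _ _ _ hd₁ hd₂ (by norm_num) (by norm_num) (by norm_num) (by norm_num)
    have hsplit : u * r * u⁻¹ = (r * r) * ((r * r)⁻¹ * (u * r * u⁻¹)) := by rw [mul_inv_cancel_left]
    have hrr : φ₂ (r * r) = 0 := by rw [hφ₂, hφ₂r, smul_zero, add_zero]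
    have hzero : φ₂ (u * r * u⁻¹) = 0 := by rw [hsplit, hφ₂ (r * r), hv₀, smul_zero, add_zero, hrr]
    have hconj : φ₂ (u * r * u⁻¹) = φ₂ u - (u * r * u⁻¹) • φ₂ u := by
      rw [cocycle_conj hφ₂, hφ₂r, smul_zero, add_zero]
    have hv₀y : ((r * r)⁻¹ * (u * r * u⁻¹)) • φ₂ u = φ₂ u :=
      fixD' _ _ _ _ _ hd₁ hd₂ (by norm_num) (by norm_num) (by norm_num) (by norm_num) _ (h2φ₂ u)
    rw [hzero, hsplit, mul_smul, hv₀y, eq_comm, sub_eq_zero, eq_comm] at hconj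
    exact eq_zero_of_two_torsion_fixed_rr hspan hindep hqP₁ hqP₂ hrrP₁ hrrP₂ (h2φ₂ u) hconj
  have hφ₂ℓ : φ₂ ℓ = 0 := by
    rw [show ℓ = u⁻¹ * r by rw [hr, inv_mul_cancel_left], hφ₂, hφ₂r, smul_zero, add_zero,
      cocycle_inv hφ₂, hφ₂u, smul_zero, neg_zero]
  have hφ₂rr : φ₂ (r * r) = 0 := by rw [hφ₂, hφ₂r, smul_zero, add_zero]
  have hφ₂ru : φ₂ (r * u) = 0 := by rw [hφ₂, hφ₂r, hφ₂u, smul_zero, add_zero]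
  ------------------------------------------------------------------------------------------------
  -- Step 5: every `g` is `≡ 1, u, ℓ, r, r², ru (mod V_1)`
  have hall : ∀ a, φ₂ a = 0 := by
    intro x
    obtain ⟨a, c, hg₁'⟩ := hspan (x • P₁)
    obtain ⟨b, d, hg₂'⟩ := hspan (x • P₂)
    have dead₁ : (2 : ℤ) ∣ a → (2 : ℤ) ∣ c → False := fun ha hc ↦ by
      obtain ⟨α, rfl⟩ := ha
      obtain ⟨γ, rfl⟩ := hc
      obtain ⟨y, hy⟩ := exists_eq_two_smul_of_smul_eq x (x := P₁) (y := α • P₁ + γ • P₂) (by rw [hg₁']; module)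
      exact basis_fst_ne_two_smul h2q hspan hindep y hy
    have dead₂ : (2 : ℤ) ∣ b → (2 : ℤ) ∣ d → False := fun hb hd ↦ by
      obtain ⟨β, rfl⟩ := hb
      obtain ⟨δ, rfl⟩ := hd
      obtain ⟨y, hy⟩ := exists_eq_two_smul_of_smul_eq x (x := P₂) (y := β • P₁ + δ • P₂) (by rw [hg₂']; module)
      exact basis_snd_ne_two_smul h2q hspan hindep y hy
    have dead₃ : (2 : ℤ) ∣ a - b → (2 : ℤ) ∣ c - d → False := fun hab hcd ↦ by
      obtain ⟨α, hα⟩ := hab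
      obtain ⟨γ, hγ⟩ := hcd
      obtain rfl : a = b + 2 * α := by omega
      obtain rfl : c = d + 2 * γ := by omega
      obtain ⟨y, hy⟩ := exists_eq_two_smul_of_smul_eq x (x := P₁ - P₂) (y := α • P₁ + γ • P₂)
        (by rw [smul_sub, hg₁', hg₂']; module)
      exact basis_sub_ne_two_smul h2q hspan hindep y hy
    have live : ∀ w : Γ, φ₂ w = 0 → ∀ A B C D : ℤ, (w⁻¹ * x) • P₁ = A • P₁ + C • P₂ →
        (w⁻¹ * x) • P₂ = B • P₁ + D • P₂ → A % 2 = 1 → B % 2 = 0 → C % 2 = 0 → D % 2 = 1 → φ₂ x = 0 := by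
      intro w hw A B C D h₁ h₂ hA hB hC hD
      rw [show x = w * (w⁻¹ * x) by rw [mul_inv_cancel_left], cocycle_mul_of_eq_zero_left hφ₂ hw,
        hV₂' _ A B C D h₁ h₂ hA hB hC hD, smul_zero]
    rcases Int.emod_two_eq_zero_or_one a with ha | ha <;>
    rcases Int.emod_two_eq_zero_or_one b with hb | hb <;>
    rcases Int.emod_two_eq_zero_or_one c with hc | hc <;>
    rcases Int.emod_two_eq_zero_or_one d with hd | hd
    · exact (dead₁ (by omega) (by omega)).elim
    · exact (dead₁ (by omega) (by omega)).elim
    · exact (dead₂ (by omega) (by omega)).elim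
    · exact (dead₃ (by omega) (by omega)).elim
    · exact (dead₁ (by omega) (by omega)).elim
    · exact (dead₁ (by omega) (by omega)).elim
    · -- `(0 1; 1 0)`: `w = r u`
      refine live (r * u) hφ₂ru (2 * a - 3 * c) (2 * b - 3 * d) (2 * c - a) (2 * d - b) ?_ ?_
        (by omega) (by omega) (by omega) (by omega)
      · simp only [mul_smul, mul_inv_rev, hriP₁, hriP₂, hg₁', smul_add, smul_zsmul_comm, huiP₁, huiP₂, smul_sub,
          smul_neg]; module
      · simp only [mul_smul, mul_inv_rev, hriP₁, hriP₂, hg₂', smul_add, smul_zsmul_comm, huiP₁, huiP₂, smul_sub,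
          smul_neg]; module
    · -- `(0 1; 1 1)`: `w = r`
      refine live r hφ₂r (a - c) (b - d) (2 * c - a) (2 * d - b) ?_ ?_ (by omega) (by omega) (by omega) (by omega)
      · simp only [mul_smul, hriP₁, hriP₂, hg₁', smul_add, smul_zsmul_comm, smul_sub, smul_neg]; module
      · simp only [mul_smul, hriP₁, hriP₂, hg₂', smul_add, smul_zsmul_comm, smul_sub, smul_neg]; module
    · exact (dead₂ (by omega) (by omega)).elim
    · -- `1`
      refine live 1 (cocycle_one hφ₂) a b c d ?_ ?_ (by omega) (by omega) (by omega) (by omega)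
      · rw [inv_one, one_mul, hg₁']
      · rw [inv_one, one_mul, hg₂']
    · exact (dead₂ (by omega) (by omega)).elim
    · -- `(1 0; 1 1)`: `w = ℓ`
      refine live ℓ hφ₂ℓ a b (c - a) (d - b) ?_ ?_ (by omega) (by omega) (by omega) (by omega)
      · simp only [mul_smul, hg₁', smul_add, smul_zsmul_comm, hℓiP₁, hℓiP₂, smul_sub]; module
      · simp only [mul_smul, hg₂', smul_add, smul_zsmul_comm, hℓiP₁, hℓiP₂, smul_sub]; module
    · exact (dead₃ (by omega) (by omega)).elim
    · -- `(1 1; 0 1)`: `w = u`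
      refine live u hφ₂u (a - c) (b - d) c d ?_ ?_ (by omega) (by omega) (by omega) (by omega)
      · simp only [mul_smul, hg₁', smul_add, smul_zsmul_comm, huiP₁, huiP₂, smul_sub]; module
      · simp only [mul_smul, hg₂', smul_add, smul_zsmul_comm, huiP₁, huiP₂, smul_sub]; module
    · -- `(1 1; 1 0)`: `w = r²`
      refine live (r * r) hφ₂rr (2 * a - 3 * c) (2 * b - 3 * d) (5 * c - 3 * a) (5 * d - 3 * b) ?_ ?_
        (by omega) (by omega) (by omega) (by omega)
      · simp only [mul_smul, mul_inv_rev, hriP₁, hriP₂, hg₁', smul_add, smul_zsmul_comm, smul_sub, smul_neg]; module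
      · simp only [mul_smul, mul_inv_rev, hriP₁, hriP₂, hg₂', smul_add, smul_zsmul_comm, smul_sub, smul_neg]; module
    · exact (dead₃ (by omega) (by omega)).elim
  refine ⟨m₃, fun a ↦ ?_⟩
  have := hall a
  rwa [hφ₂app, sub_eq_zero] at this

end Core

/-! ## §5 The `−1` trick and the normalisation at `u` -/

section General

variable {P₁ P₂ : M} {q : ℤ} {L : ℕ}

/-- **Core, general values: the `−1` trick at level `2^L`.**  With `φ u = 0` only: `φ a + φ a = φ z₋ − a • φ z₋` for the central
`z₋ = −1`; `φ z₋ = a • P₁` with `a ≡ −2β (mod q)` where `φ ℓ = α P₁ + β P₂`; `φ − d(β P₁)` has `2`-torsion values and still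
vanishes at `u`. [cite: LawsonWuthrich2016, §7.1 and §8] -/
theorem coboundary_of_apply_transvection_eq_zero (hL : 1 ≤ L) (hq : q = 2 ^ L) (hqM : ∀ m : M, q • m = 0)
    (hspan : ∀ m : M, ∃ a b : ℤ, m = a • P₁ + b • P₂)
    (hindep : ∀ a b : ℤ, a • P₁ + b • P₂ = 0 → q ∣ a ∧ q ∣ b)
    {u ℓ s zneg : Γ} (huP₁ : u • P₁ = P₁) (huP₂ : u • P₂ = P₁ + P₂)
    (hℓP₁ : ℓ • P₁ = P₁ + P₂) (hℓP₂ : ℓ • P₂ = P₂) (hsP₁ : s • P₁ = P₂) (hsP₂ : s • P₂ = P₁)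
    (hzneg : ∀ m : M, zneg • m = -m)
    {z g : ℕ → Γ} (hz : ∀ i, 1 ≤ i → ∀ m : M, z i • m = (1 + 2 ^ i : ℤ) • m)
    (hg₁ : ∀ i, 1 ≤ i → g i • P₁ = (1 + 2 ^ i : ℤ) • P₁) (hg₂ : ∀ i, 1 ≤ i → g i • P₂ = P₂)
    {φ : Γ → M} (hφ : ∀ a b, φ (a * b) = φ a + a • φ b)
    (hker : ∀ ρ : Γ, (∀ m : M, ρ • m = m) → φ ρ = 0) (hφu : φ u = 0) :
    ∃ m : M, ∀ a, φ a = a • m - m := by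
  have hqP₁ := hqM P₁
  have hqP₂ := hqM P₂
  have hE : ∀ a : Γ, φ a + φ a = φ zneg - a • φ zneg := by
    intro a
    have hcomm : ∀ m : M, (a * zneg) • m = (zneg * a) • m := fun m ↦ by
      rw [mul_smul, mul_smul, hzneg, hzneg, smul_neg]
    have h := cocycle_eq_of_forall_smul_eq hφ hker hcomm
    rw [hφ, hφ, hzneg] at h
    rw [eq_sub_iff_add_eq, add_assoc, h]
    abel
  obtain ⟨a, b, hab⟩ := hspan (φ zneg)
  have hb : q ∣ b := by
    have h := hE u
    rw [hφu, add_zero, hab, smul_lincomb, huP₁, huP₂] at h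
    have h0 : (-b) • P₁ + (0 : ℤ) • P₂ = 0 := by
      rw [show (-b) • P₁ + (0 : ℤ) • P₂ = a • P₁ + b • P₂ - (a • P₁ + b • (P₁ + P₂)) by module]
      exact h.symm
    have := (hindep _ _ h0).1
    rwa [dvd_neg] at this
  have hc : φ zneg = a • P₁ := by rw [hab, zsmul_eq_zero_of_dvd hqP₂ hb, add_zero]
  obtain ⟨α, β, hαβ⟩ := hspan (φ ℓ)
  have ha : q ∣ 2 * β + a := by
    have h := hE ℓ
    rw [hαβ, hc, smul_zsmul_comm, hℓP₁] at h
    have h0 : (2 * α) • P₁ + (2 * β + a) • P₂ = 0 := by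
      rw [show (2 * α) • P₁ + (2 * β + a) • P₂ = α • P₁ + β • P₂ + (α • P₁ + β • P₂) - (a • P₁ - a • (P₁ + P₂))
        by module, h, sub_self]
    exact (hindep _ _ h0).2
  -- `φ zneg = -(2β) • P₁`
  have hc' : φ zneg = (-(2 * β)) • P₁ := by
    rw [hc]; exact lincomb_congr (P₂ := P₂) hqP₁ hqP₂ (b := 0) (b' := 0) (by rw [show a - -(2 * β) = 2 * β + a by ring]; exact ha)
      (by simp) |>.trans (by rw [zero_smul, add_zero]) |> fun h ↦ by rw [zero_smul, add_zero] at h; exact h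
  -- shift by `d(β • P₁)`
  obtain ⟨c₁, hc₁⟩ : ∃ c₁ : M, c₁ = β • P₁ := ⟨_, rfl⟩
  obtain ⟨φ₁, hφ₁def⟩ : ∃ φ₁ : Γ → M, φ₁ = fun x ↦ φ x - (x • c₁ - c₁) := ⟨_, rfl⟩
  have hφ₁app : ∀ x, φ₁ x = φ x - (x • c₁ - c₁) := fun x ↦ by rw [hφ₁def]
  have hφ₁ : ∀ x y, φ₁ (x * y) = φ₁ x + x • φ₁ y := by rw [hφ₁def]; exact cocycle_sub_coboundary hφ c₁
  have hker₁ : ∀ ρ : Γ, (∀ m : M, ρ • m = m) → φ₁ ρ = 0 := by rw [hφ₁def]; exact ker_sub_coboundary hker c₁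
  have hφ₁u : φ₁ u = 0 := by rw [hφ₁app, hφu, hc₁, smul_zsmul_comm, huP₁, sub_self, sub_zero]
  have h2φ₁ : ∀ x, (2 : ℤ) • φ₁ x = 0 := by
    intro x
    rw [hφ₁app, two_zsmul, show φ x - (x • c₁ - c₁) + (φ x - (x • c₁ - c₁)) =
      (φ x + φ x) - (x • (c₁ + c₁) - (c₁ + c₁)) by rw [smul_add]; abel, hE x, hc',
      show c₁ + c₁ = (2 * β) • P₁ by rw [hc₁]; module, smul_zsmul_comm, smul_zsmul_comm]
    generalize x • P₁ = y
    module
  obtain ⟨v, hv⟩ := coboundary_of_two_torsion_values hL hq hqM hspan hindep huP₁ huP₂ hℓP₁ hℓP₂ hsP₁ hsP₂ hz hg₁ hg₂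
    hφ₁ hker₁ hφ₁u h2φ₁
  refine ⟨v + c₁, fun x ↦ ?_⟩
  have := hv x
  rw [hφ₁app, sub_eq_iff_eq_add] at this
  rw [this, smul_add]
  abel

/-- **THE NON-PHANTOM LEMMA, basis form, every level `q = 2^L`.**  Basis `P₁, P₂` of `M` mod `q`; `u, s, zneg` acting as
`(1 1; 0 1)`, `(0 1; 1 0)`, `−1`; the families `z i = 1 + 2^i` (scalar) and `g i = diag(1 + 2^i, 1)`; `φ` a cocycle vanishing on
the kernel of the action and PRINCIPAL on `u`.  Then `φ` is a coboundary: restriction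
`H¹(GL₂(ℤ/2^L), (ℤ/2^L)²) → H¹(⟨u⟩, (ℤ/2^L)²)` is injective. [cite: LawsonWuthrich2016, §7.1 and §8] -/
theorem coboundary_of_basis_data (hL : 1 ≤ L) (hq : q = 2 ^ L) (hqM : ∀ m : M, q • m = 0)
    (hspan : ∀ m : M, ∃ a b : ℤ, m = a • P₁ + b • P₂)
    (hindep : ∀ a b : ℤ, a • P₁ + b • P₂ = 0 → q ∣ a ∧ q ∣ b)
    {u s zneg : Γ} (huP₁ : u • P₁ = P₁) (huP₂ : u • P₂ = P₁ + P₂)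
    (hsP₁ : s • P₁ = P₂) (hsP₂ : s • P₂ = P₁) (hzneg : ∀ m : M, zneg • m = -m)
    {z g : ℕ → Γ} (hz : ∀ i, 1 ≤ i → ∀ m : M, z i • m = (1 + 2 ^ i : ℤ) • m)
    (hg₁ : ∀ i, 1 ≤ i → g i • P₁ = (1 + 2 ^ i : ℤ) • P₁) (hg₂ : ∀ i, 1 ≤ i → g i • P₂ = P₂)
    {φ : Γ → M} (hφ : ∀ a b, φ (a * b) = φ a + a • φ b)
    (hker : ∀ ρ : Γ, (∀ m : M, ρ • m = m) → φ ρ = 0) (hφu : ∃ m : M, φ u = u • m - m) :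
    ∃ m : M, ∀ a, φ a = a • m - m := by
  have hsiP₁ : s⁻¹ • P₁ = P₂ := by rw [inv_smul_eq_iff, hsP₂]
  have hsiP₂ : s⁻¹ • P₂ = P₁ := by rw [inv_smul_eq_iff, hsP₁]
  have hℓP₁ : (s * u * s⁻¹) • P₁ = P₁ + P₂ := by
    rw [mul_smul, mul_smul, hsiP₁, huP₂, smul_add, hsP₁, hsP₂, add_comm]
  have hℓP₂ : (s * u * s⁻¹) • P₂ = P₂ := by rw [mul_smul, mul_smul, hsiP₂, huP₁, hsP₁]
  obtain ⟨m₀, hm₀⟩ := hφu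
  obtain ⟨φ₀, hφ₀def⟩ : ∃ φ₀ : Γ → M, φ₀ = fun x ↦ φ x - (x • m₀ - m₀) := ⟨_, rfl⟩
  have hφ₀app : ∀ x, φ₀ x = φ x - (x • m₀ - m₀) := fun x ↦ by rw [hφ₀def]
  have hφ₀ : ∀ x y, φ₀ (x * y) = φ₀ x + x • φ₀ y := by rw [hφ₀def]; exact cocycle_sub_coboundary hφ m₀
  have hker₀ : ∀ ρ : Γ, (∀ m : M, ρ • m = m) → φ₀ ρ = 0 := by rw [hφ₀def]; exact ker_sub_coboundary hker m₀
  have hφ₀u : φ₀ u = 0 := by rw [hφ₀app, hm₀, sub_self]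
  obtain ⟨v, hv⟩ := coboundary_of_apply_transvection_eq_zero hL hq hqM hspan hindep huP₁ huP₂ hℓP₁ hℓP₂ hsP₁ hsP₂ hzneg
    hz hg₁ hg₂ hφ₀ hker₀ hφ₀u
  refine ⟨v + m₀, fun x ↦ ?_⟩
  have := hv x
  rw [hφ₀app, sub_eq_iff_eq_add] at this
  rw [this, smul_add]
  abel

end General

end Summit.BirchSwinnertonDyer.BirchSwinnertonDyer.Theorems.GenusExact.NonPhantomPow
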